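import Literature.Barriers.CriticalPhenomena.LaceExpansionXSpaceAsymptotics
import Literature.Barriers.CriticalPhenomena.LaceExpansionConvergence
import Mathlib.Analysis.SpecialFunctions.Integrals.Basic
import HarnessLib

/-!
# Analysis on the cube `[-π, π]^d` for the derivation "infrared bound ⟹ triangle condition"

Topic `Literature/Probability/Percolation`, family `crit-perc`. Theorem-only toolbox for
`InfraredBoundTriangle.lean` (Heydenreich–van der Hofstad 2017, proof of Cor. 5.2,
(5.1.5)–(5.1.12); Fitzner–van der Hofstad 2017, §1.3, the display preceding Cor. 1.3):

* **Orthogonality of the characters** on the cube `Q = [-π,π]^d` with Lebesgue measure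
  (`Slade2006Prop53.P d = μI^{⊗ d}`, `LaceExpansionConvergence.lean`):
  `∫_Q e^{-ik·w} dk = (2π)^d 𝟙{w = 0}` for `w ∈ ℤ^d` (`integral_cexp_neg_kdot`; Fubini and
  `∫_{-π}^{π} e^{-int} dt = 2π 𝟙{n = 0}`, `integral_cexp_neg_int_mul`);
* **the cube of a lattice Fourier transform** `f̂(k) = Σ_x f(x) e^{-ik·x}`
  (`Literature.Barriers.CriticalPhenomena.latticeFT`, Hara's sign convention) for absolutely
  summable `f : ℤ^d → ℝ`: `f̂(k)³ = Σ_{x,y,z} f(x)f(y)f(z) e^{-ik·(x+y+z)}` (`latticeFT_pow_three`) and,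
  integrating term by term (dominated by `(Σ|f|)³ (2π)^d`),
  `∫_Q f̂(k)³ dk = (2π)^d Σ_{y,z} f(-(y+z)) f(y) f(z)` (`integral_latticeFT_pow_three`) — the
  elementary form of "`Δ_p = τ_p^{⋆3}(0) = ∫ τ̂_p(k)³ dk/(2π)^d`" ((5.1.5)–(5.1.8)), with no appeal
  to a general inversion theorem;
* **the torus integral `∫_Q S(k)^{-3} dk` is finite for `d ≥ 7`**, where
  `S(k) = Σ_j (1 - cos k_j) = d (1 - D̂(k))` (`Slade2006Prop53.S`): dyadic shells in `S` and the
  Chernoff bound `vol{S ≤ dt} ≤ (e √(π³t/2))^d` (`Slade2006Prop53.measure_S_le`) give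
  `∫_Q S^{-3} ≤ (2π)^d + 128 (4π)^d < ∞` (`lintegral_inv_S_pow_three_lt_top`,
  `integrable_inv_S_pow_three`); together with `2 S(k) ≤ |k|²` (`two_mul_S_le_sum_sq`, from
  `1 - cos u ≤ u²/2`) this is the case `n = 3` of (5.1.10)–(5.1.12) ("finite if (and only if)
  `d > 2n`"; only the "if" direction, and only for the nearest-neighbour `D̂`);
* `P_singleton_zero`: the origin is a null set of `Q` (`d ≥ 1`).

Design. Everything is stated over existing objects: `kdot`, `latticeFT`
(`Barriers/CriticalPhenomena/GaussianDominationRoute.lean`, `LaceExpansionXSpaceAsymptotics.lean`)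
and `Slade2006Prop53.{μI, P, S}` (`LaceExpansionConvergence.lean`); no definition is introduced.
Mathlib has multiple Fourier series on `UnitAddTorus` (`hasSum_mFourier_series_of_summable`) but
the percolation infrared bound (`PercInfraredBound`, `tauHat`) lives on the cube `[-π,π]^d ⊆ ℝ^d`
with Lebesgue measure, where the two identities above are quicker to prove directly than to
transport.

## References

* M. Heydenreich, R. van der Hofstad, *Progress in High-Dimensional Percolation and Random
  Graphs*, Springer 2017: proof of Cor. 5.2, (5.1.5)–(5.1.12), Exercise 5.1.
* R. Fitzner, R. van der Hofstad, *Mean-field behavior for nearest-neighbor percolation in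
  `d > 10`*, Electron. J. Probab. 22 (2017) no. 43: §1.3 (display preceding Cor. 1.3).
* G. Slade, *The Lace Expansion and its Applications*, LNM 1879 (2006), Prop. 5.3 (the
  Chernoff-bound route to such torus integrals, as formalised in `LaceExpansionConvergence.lean`).
-/

noncomputable section

namespace Literature.Probability.Percolation

open MeasureTheory Filter Topology Real
open Literature.Probability.LatticeModels
open Literature.Barriers.CriticalPhenomena
open Literature.Barriers.CriticalPhenomena.Slade2006Prop53
open scoped ENNReal

variable {d : ℕ}

/-! ### Lattice Fourier analysis on the cube `[-π, π]^d` -/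

/-- `k · (x + y) = k · x + k · y`. [folklore] -/
theorem kdot_add (k : Fin d → ℝ) (x y : Site d) : kdot k (x + y) = kdot k x + kdot k y := by
  simp only [kdot, Pi.add_apply, Int.cast_add, mul_add, Finset.sum_add_distrib]

/-- `k · (-x) = -(k · x)`. [folklore] -/
theorem kdot_neg (k : Fin d → ℝ) (x : Site d) : kdot k (-x) = -kdot k x := by
  simp only [kdot, Pi.neg_apply, Int.cast_neg, mul_neg, Finset.sum_neg_distrib]

/-- `∫_{-π}^{π} e^{-i n t} dt = 2π 𝟙{n = 0}` for an integer `n`. [folklore] -/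
theorem integral_cexp_neg_int_mul (n : ℤ) :
    ∫ t, Complex.exp (-(Complex.I * ((n : ℝ) * t : ℝ))) ∂μI =
      if n = 0 then (2 * π : ℂ) else 0 := by
  unfold μI
  rw [integral_Icc_eq_integral_Ioc, ← intervalIntegral.integral_of_le (by linarith [pi_pos])]
  split_ifs with hn
  · subst hn
    simp; ring
  · have hc : (-(Complex.I * (n : ℂ))) ≠ 0 := by
      simp [Complex.I_ne_zero, hn]
    have key : ∀ t : ℝ, Complex.exp (-(Complex.I * ((n : ℝ) * t : ℝ))) =
        Complex.exp (-(Complex.I * (n : ℂ)) * t) := by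
      intro t; congr 1; push_cast; ring
    simp_rw [key]
    rw [integral_exp_mul_complex hc]
    have hper : Complex.exp (-(Complex.I * (n : ℂ)) * (π : ℝ)) =
        Complex.exp (-(Complex.I * (n : ℂ)) * (-π : ℝ)) := by
      rw [← mul_inv_eq_one₀ (Complex.exp_ne_zero _), ← Complex.exp_neg, ← Complex.exp_add]
      have : -(Complex.I * (n : ℂ)) * ((π : ℝ) : ℂ) + -(-(Complex.I * (n : ℂ)) * ((-π : ℝ) : ℂ)) =
          ((-n : ℤ) : ℂ) * (2 * π * Complex.I) := by push_cast; ring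
      rw [this, Complex.exp_int_mul_two_pi_mul_I]
    rw [hper, sub_self, zero_div]


/-- **Orthogonality of the characters on the cube**: `∫_{[-π,π]^d} e^{-i k·w} dk = (2π)^d 𝟙{w = 0}`
for `w ∈ ℤ^d` (Fubini over the product measure and the one-dimensional integrals).
[cite: HeydenreichVanDerHofstad2017, (5.1.6) (Fourier inversion on (-π,π]^d)] -/
theorem integral_cexp_neg_kdot (w : Site d) :
    ∫ k, Complex.exp (-(Complex.I * (kdot k w : ℝ))) ∂P d =
      if w = 0 then ((2 * π) ^ d : ℂ) else 0 := by
  set f : Fin d → ℝ → ℂ := fun j t => Complex.exp (-(Complex.I * (((w j : ℝ) * t : ℝ) : ℂ))) with hf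
  have key : ∀ k : Fin d → ℝ, Complex.exp (-(Complex.I * (kdot k w : ℝ))) = ∏ j, f j (k j) := by
    intro k
    rw [← Complex.exp_sum]
    congr 1
    simp only [kdot, Complex.ofReal_sum, Finset.mul_sum, ← Finset.sum_neg_distrib]
    refine Finset.sum_congr rfl fun j _ => ?_
    push_cast; ring
  simp_rw [key]
  have hprod := integral_fintype_prod_eq_prod (𝕜 := ℂ) f (μ := fun _ : Fin d => μI)
  rw [show P d = Measure.pi (fun _ : Fin d => μI) from rfl, hprod]
  have hj : ∀ j, ∫ t, f j t ∂μI = if w j = 0 then (2 * π : ℂ) else 0 := fun j =>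
    integral_cexp_neg_int_mul (w j)
  simp_rw [hj]
  split_ifs with hw
  · subst hw
    simp
  · obtain ⟨j, hj⟩ : ∃ j, w j ≠ 0 := by
      by_contra h
      push Not at h
      exact hw (funext h)
    exact Finset.prod_eq_zero (Finset.mem_univ j) (if_neg hj)


section CubeOfFT

variable {a : Site d → ℝ}

/-- The terms of `f̂(k)³` written as one family over triples. [folklore] -/
theorem latticeFT_pow_three (ha : Summable fun x => |a x|) (k : Fin d → ℝ) :
    latticeFT a k ^ 3 = ∑' t : Site d × Site d × Site d,
      ((a t.1 * a t.2.1 * a t.2.2 : ℝ) : ℂ) *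
        Complex.exp (-(Complex.I * (kdot k (t.1 + t.2.1 + t.2.2) : ℝ))) := by
  set F : Site d → ℂ := fun x => (a x : ℂ) * Complex.exp (-(Complex.I * (kdot k x : ℝ))) with hF
  have hFn : ∀ x, ‖F x‖ = |a x| := by
    intro x
    rw [hF]
    simp only [norm_mul, Complex.norm_real, Real.norm_eq_abs, Complex.norm_exp]
    simp
  have hFs : Summable fun x => ‖F x‖ := by simpa only [hFn] using ha
  have hFF : Summable fun yz : Site d × Site d => ‖F yz.1 * F yz.2‖ := by
    simp only [norm_mul]
    exact hFs.mul_of_nonneg hFs (fun _ => norm_nonneg _) (fun _ => norm_nonneg _)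
  have h2 : (∑' x, F x) * (∑' x, F x) = ∑' yz : Site d × Site d, F yz.1 * F yz.2 :=
    tsum_mul_tsum_of_summable_norm hFs hFs
  have h3 : (∑' x, F x) * (∑' yz : Site d × Site d, F yz.1 * F yz.2) =
      ∑' t : Site d × Site d × Site d, F t.1 * (F t.2.1 * F t.2.2) :=
    tsum_mul_tsum_of_summable_norm hFs hFF
  have hft : latticeFT a k = ∑' x, F x := rfl
  rw [show latticeFT a k ^ 3 = latticeFT a k * (latticeFT a k * latticeFT a k) by ring, hft, h2, h3]
  refine tsum_congr fun t => ?_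
  simp only [hF, kdot_add, Complex.ofReal_add, Complex.ofReal_mul, mul_add, neg_add,
    Complex.exp_add]
  ring

/-- The triple family is absolutely summable. [folklore] -/
theorem summable_abs_triple (ha : Summable fun x => |a x|) :
    Summable fun t : Site d × Site d × Site d => |a t.1 * a t.2.1 * a t.2.2| := by
  have h2 : Summable fun yz : Site d × Site d => |a yz.1| * |a yz.2| :=
    ha.mul_of_nonneg ha (fun _ => abs_nonneg _) (fun _ => abs_nonneg _)
  have h3 := ha.mul_of_nonneg h2 (fun _ => abs_nonneg _)
    (fun _ => mul_nonneg (abs_nonneg _) (abs_nonneg _))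
  refine h3.congr fun t => ?_
  simp only [abs_mul]
  ring

/-- **`∫_{[-π,π]^d} f̂(k)³ dk = (2π)^d Σ_{y,z} f(-(y+z)) f(y) f(z)`** for absolutely summable
`f : ℤ^d → ℝ`: expand the cube, integrate term by term (dominated by `Σ|f|³ · (2π)^d`), and use
orthogonality; only the triples with `x + y + z = 0` survive. This is (5.1.5)–(5.1.8) of
Heydenreich–van der Hofstad (`Δ_p = τ_p^{⋆3}(0) = ∫ τ̂_p(k)³ dk/(2π)^d`) in elementary form.
[cite: HeydenreichVanDerHofstad2017, (5.1.5)–(5.1.8)] -/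
theorem integral_latticeFT_pow_three (ha : Summable fun x => |a x|) :
    ∫ k, latticeFT a k ^ 3 ∂P d =
      ((2 * π) ^ d : ℂ) * ∑' yz : Site d × Site d,
        ((a (-(yz.1 + yz.2)) * a yz.1 * a yz.2 : ℝ) : ℂ) := by
  classical
  set c : Site d × Site d × Site d → ℝ := fun t => a t.1 * a t.2.1 * a t.2.2 with hc
  set G : Site d × Site d × Site d → (Fin d → ℝ) → ℂ := fun t k =>
    (c t : ℂ) * Complex.exp (-(Complex.I * (kdot k (t.1 + t.2.1 + t.2.2) : ℝ))) with hG
  have hexp : ∀ k, latticeFT a k ^ 3 = ∑' t, G t k := fun k => latticeFT_pow_three ha k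
  simp_rw [hexp]
  -- continuity of `k ↦ k·w`
  have hkdot : ∀ w : Site d, Continuous fun k : Fin d → ℝ => kdot k w := by
    intro w
    unfold kdot
    fun_prop
  have hGm : ∀ t, AEStronglyMeasurable (G t) (P d) := by
    intro t
    refine Continuous.aestronglyMeasurable ?_
    simp only [hG]
    exact continuous_const.mul (Complex.continuous_exp.comp
      ((Complex.continuous_ofReal.comp (hkdot _)).const_mul _).neg)
  have hGnorm : ∀ t k, ‖G t k‖ₑ = ‖c t‖ₑ := by
    intro t k
    rw [← ofReal_norm, ← ofReal_norm]
    congr 1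
    simp only [hG, norm_mul, Complex.norm_real, Complex.norm_exp]
    simp
  have hsum : ∑' t, ∫⁻ k, ‖G t k‖ₑ ∂P d ≠ ⊤ := by
    simp_rw [hGnorm, lintegral_const]
    rw [ENNReal.tsum_mul_right]
    refine ENNReal.mul_ne_top ?_ (measure_ne_top _ _)
    have habs := summable_abs_triple ha
    have : ∑' t, ‖c t‖ₑ = ENNReal.ofReal (∑' t, |c t|) := by
      rw [ENNReal.ofReal_tsum_of_nonneg (fun _ => abs_nonneg _) habs]
      refine tsum_congr fun t => ?_
      rw [← ofReal_norm, Real.norm_eq_abs]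
    rw [this]
    exact ENNReal.ofReal_ne_top
  rw [integral_tsum hGm hsum]
  -- evaluate each term by orthogonality
  have hterm : ∀ t, ∫ k, G t k ∂P d =
      (c t : ℂ) * (if t.1 + t.2.1 + t.2.2 = 0 then ((2 * π) ^ d : ℂ) else 0) := by
    intro t
    simp only [hG]
    rw [integral_const_mul, integral_cexp_neg_kdot]
  simp_rw [hterm]
  -- only `x = -(y+z)` survives
  set g : Site d × Site d → Site d × Site d × Site d := fun yz => (-(yz.1 + yz.2), yz) with hg
  have hginj : Function.Injective g := fun yz yz' h => (Prod.ext_iff.1 h).2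
  have hsupp : (Function.support fun t : Site d × Site d × Site d =>
      (c t : ℂ) * (if t.1 + t.2.1 + t.2.2 = 0 then ((2 * π) ^ d : ℂ) else 0)) ⊆ Set.range g := by
    intro t ht
    rw [Function.mem_support] at ht
    have h0 : t.1 + t.2.1 + t.2.2 = 0 := by
      by_contra h
      exact ht (by rw [if_neg h, mul_zero])
    refine ⟨t.2, ?_⟩
    simp only [hg]
    ext1
    · show -(t.2.1 + t.2.2) = t.1
      rw [add_assoc] at h0
      exact (eq_neg_of_add_eq_zero_left h0).symm
    · rfl
  rw [← hginj.tsum_eq hsupp]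
  simp only [hg, hc]
  rw [← tsum_mul_left]
  refine tsum_congr fun yz => ?_
  have : -(yz.1 + yz.2) + yz.1 + yz.2 = 0 := by abel
  rw [if_pos this, mul_comm]

end CubeOfFT


/-! ### The torus integral `∫_{[-π,π]^d} S(k)^{-3} dk` is finite for `d ≥ 7`

Here `S(k) = Σ_j (1 - cos k_j) = d (1 - D̂(k))` (`Slade2006Prop53.S`); by `1 - cos u ≤ u²/2`,
`2 S(k) ≤ |k|²`, so `|k|^{-6} ≤ (2 S(k))^{-3}`, and the finiteness of `∫ S^{-3}` for `d > 6` is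
the statement "(5.1.12) is finite if (and only if) `d > 2n`" with `n = 3`
(Heydenreich–van der Hofstad 2017, proof of Cor. 5.2). We prove it by dyadic shells in `S`
and the Chernoff bound `vol{S ≤ dt} ≤ (e √(π³t/2))^d` of `Slade2006Prop53.measure_S_le`. -/

/-- `2 S(k) ≤ Σ_j k_j²` (from `1 - cos u ≤ u²/2`). [cite: HeydenreichVanDerHofstad2017, Exercise 5.1] -/
theorem two_mul_S_le_sum_sq (k : Fin d → ℝ) : 2 * S d k ≤ ∑ j, k j ^ 2 := by
  unfold S
  rw [Finset.mul_sum]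
  refine Finset.sum_le_sum fun j _ => ?_
  linarith [Real.one_sub_sq_div_two_le_cos (x := k j)]

/-- Dyadic splitting: `S⁻³ ≤ 1 + Σ_{m ≥ 0} 64^{m+1} 𝟙{S ≤ 4^{-m}}` (in `[0, ∞]`). [folklore] -/
theorem ofReal_inv_S_pow_three_le (k : Fin d → ℝ) :
    ENNReal.ofReal ((S d k)⁻¹ ^ 3) ≤
      1 + ∑' m : ℕ, Set.indicator {k | S d k ≤ (1 / 4 : ℝ) ^ m} (fun _ => (64 : ℝ≥0∞) ^ (m + 1)) k := by
  rcases (S_nonneg d k).eq_or_lt with h0 | hpos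
  · rw [← h0]; simp
  by_cases h1 : 1 < S d k
  · refine le_add_right ?_
    rw [← ENNReal.ofReal_one]
    refine ENNReal.ofReal_le_ofReal ?_
    have : (S d k)⁻¹ ≤ 1 := inv_le_one_of_one_le₀ h1.le
    calc (S d k)⁻¹ ^ 3 ≤ 1 ^ 3 := pow_le_pow_left₀ (inv_nonneg.2 hpos.le) this 3
      _ = 1 := one_pow 3
  · push Not at h1
    obtain ⟨m, hm1, hm2⟩ := exists_nat_pow_near_of_lt_one hpos h1
      (by norm_num : (0 : ℝ) < 1 / 4) (by norm_num : (1 / 4 : ℝ) < 1)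
    refine le_add_left (le_trans ?_ (ENNReal.le_tsum m))
    rw [Set.indicator_of_mem (show k ∈ {k | S d k ≤ (1 / 4 : ℝ) ^ m} from hm2)]
    have h4 : ((4 : ℝ) ^ (m + 1))⁻¹ < S d k := by rwa [one_div, inv_pow] at hm1
    have hinv : (S d k)⁻¹ < 4 ^ (m + 1) := inv_lt_of_inv_lt₀ (by positivity) h4
    have h3 : (S d k)⁻¹ ^ 3 ≤ (64 : ℝ) ^ (m + 1) := by
      have : ((4 : ℝ) ^ (m + 1)) ^ 3 = 64 ^ (m + 1) := by
        rw [← pow_mul, mul_comm, pow_mul]; norm_num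
      rw [← this]
      exact pow_le_pow_left₀ (inv_nonneg.2 hpos.le) hinv.le 3
    calc ENNReal.ofReal ((S d k)⁻¹ ^ 3) ≤ ENNReal.ofReal ((64 : ℝ) ^ (m + 1)) :=
          ENNReal.ofReal_le_ofReal h3
      _ = 64 ^ (m + 1) := by rw [ENNReal.ofReal_pow (by norm_num), ENNReal.ofReal_ofNat]

/-- The shells `{S ≤ 4^{-m}}` are measurable. [folklore] -/
theorem measurableSet_S_le (d m : ℕ) : MeasurableSet {k : Fin d → ℝ | S d k ≤ (1 / 4 : ℝ) ^ m} :=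
  measurableSet_le (continuous_S d).measurable measurable_const

/-- Chernoff bound on the shells: `vol{S ≤ 4^{-m}} ≤ (4π)^d 2^{-md}` for `d ≥ 1`. [folklore] -/
theorem measure_S_le_pow (hd : 1 ≤ d) (m : ℕ) :
    P d {k | S d k ≤ (1 / 4 : ℝ) ^ m} ≤ ENNReal.ofReal ((4 * π) ^ d * ((1 / 2 : ℝ) ^ d) ^ m) := by
  have hdpos : (0 : ℝ) < d := by exact_mod_cast hd
  have hset : {k : Fin d → ℝ | S d k ≤ (1 / 4 : ℝ) ^ m} = {k | S d k ≤ d * ((1 / 4 : ℝ) ^ m / d)} := by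
    ext k; simp only [Set.mem_setOf_eq]; rw [mul_div_cancel₀ _ hdpos.ne']
  rw [hset]
  refine (measure_S_le d (by positivity)).trans (ENNReal.ofReal_le_ofReal ?_)
  have hsq : √(π ^ 3 * ((1 / 4 : ℝ) ^ m / d) / 2) ≤ (1 / 2 : ℝ) ^ m * √(π ^ 3 / 2) := by
    have h1 : π ^ 3 * ((1 / 4 : ℝ) ^ m / d) / 2 ≤ ((1 / 2 : ℝ) ^ m) ^ 2 * (π ^ 3 / 2) := by
      have hq : ((1 / 4 : ℝ) ^ m) = ((1 / 2 : ℝ) ^ m) ^ 2 := by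
        rw [← pow_mul, mul_comm m 2, pow_mul]; norm_num
      rw [hq]
      have hle : ((1 / 2 : ℝ) ^ m) ^ 2 / d ≤ ((1 / 2 : ℝ) ^ m) ^ 2 :=
        div_le_self (by positivity) (by exact_mod_cast hd)
      nlinarith [pow_pos pi_pos 3]
    calc √(π ^ 3 * ((1 / 4 : ℝ) ^ m / d) / 2) ≤ √(((1 / 2 : ℝ) ^ m) ^ 2 * (π ^ 3 / 2)) :=
          Real.sqrt_le_sqrt h1
      _ = (1 / 2 : ℝ) ^ m * √(π ^ 3 / 2) := by
          rw [Real.sqrt_mul (sq_nonneg _), Real.sqrt_sq (by positivity)]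
  calc (rexp 1 * √(π ^ 3 * ((1 / 4 : ℝ) ^ m / d) / 2)) ^ d
      ≤ (rexp 1 * ((1 / 2 : ℝ) ^ m * √(π ^ 3 / 2))) ^ d := by gcongr
    _ = ((1 / 2 : ℝ) ^ m * (rexp 1 * √(π ^ 3 / 2))) ^ d := by ring
    _ ≤ ((1 / 2 : ℝ) ^ m * (4 * π)) ^ d :=
        pow_le_pow_left₀ (by positivity) (mul_le_mul_of_nonneg_left numeric_bound (by positivity)) d
    _ = (4 * π) ^ d * ((1 / 2 : ℝ) ^ d) ^ m := by rw [mul_pow, ← pow_mul, ← pow_mul, mul_comm d m]; ring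

/-- **`∫_{[-π,π]^d} S(k)^{-3} dk < ∞` for `d ≥ 7`** (the case `n = 3` of "the right-hand side of
(5.1.12) is finite if (and only if) `d > 2n`"). [cite: HeydenreichVanDerHofstad2017, (5.1.10)–(5.1.12)] -/
theorem lintegral_inv_S_pow_three_lt_top (hd : 7 ≤ d) :
    ∫⁻ k, ENNReal.ofReal ((S d k)⁻¹ ^ 3) ∂P d < ⊤ := by
  have hd1 : 1 ≤ d := le_trans (by norm_num) hd
  -- integrate the dyadic bound
  have step1 : ∫⁻ k, ENNReal.ofReal ((S d k)⁻¹ ^ 3) ∂P d ≤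
      P d Set.univ + ∑' m : ℕ, 64 ^ (m + 1) * P d {k | S d k ≤ (1 / 4 : ℝ) ^ m} := by
    calc _ ≤ ∫⁻ k, (1 + ∑' m : ℕ, Set.indicator {k | S d k ≤ (1 / 4 : ℝ) ^ m}
          (fun _ => (64 : ℝ≥0∞) ^ (m + 1)) k) ∂P d := lintegral_mono fun k => ofReal_inv_S_pow_three_le k
      _ = _ := by
        rw [lintegral_add_left measurable_const, lintegral_one,
          lintegral_tsum fun m => ((measurable_const.indicator (measurableSet_S_le d m)).aemeasurable)]
        congr 1
        exact tsum_congr fun m => lintegral_indicator_const (measurableSet_S_le d m) _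
  -- the geometric series
  have h64 : (64 : ℝ) * (1 / 2 : ℝ) ^ d ≤ 1 / 2 := by
    have : (1 / 2 : ℝ) ^ d ≤ (1 / 2) ^ 7 := pow_le_pow_of_le_one (by norm_num) (by norm_num) hd
    calc (64 : ℝ) * (1 / 2 : ℝ) ^ d ≤ 64 * (1 / 2) ^ 7 := by gcongr
      _ = 1 / 2 := by norm_num
  have hterm : ∀ m : ℕ, (64 : ℝ≥0∞) ^ (m + 1) * P d {k | S d k ≤ (1 / 4 : ℝ) ^ m} ≤
      ENNReal.ofReal (64 * (4 * π) ^ d) * 2⁻¹ ^ m := by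
    intro m
    have hreal : (64 : ℝ) ^ (m + 1) * ((4 * π) ^ d * ((1 / 2 : ℝ) ^ d) ^ m) ≤
        64 * (4 * π) ^ d * (1 / 2) ^ m := by
      have key : (64 : ℝ) ^ m * ((1 / 2 : ℝ) ^ d) ^ m ≤ (1 / 2) ^ m := by
        rw [← mul_pow]
        exact pow_le_pow_left₀ (by positivity) h64 m
      calc (64 : ℝ) ^ (m + 1) * ((4 * π) ^ d * ((1 / 2 : ℝ) ^ d) ^ m)
          = 64 * (4 * π) ^ d * (64 ^ m * ((1 / 2 : ℝ) ^ d) ^ m) := by rw [pow_succ]; ring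
        _ ≤ 64 * (4 * π) ^ d * (1 / 2) ^ m := by gcongr
    calc (64 : ℝ≥0∞) ^ (m + 1) * P d {k | S d k ≤ (1 / 4 : ℝ) ^ m}
        ≤ (64 : ℝ≥0∞) ^ (m + 1) * ENNReal.ofReal ((4 * π) ^ d * ((1 / 2 : ℝ) ^ d) ^ m) := by
          gcongr; exact measure_S_le_pow hd1 m
      _ = ENNReal.ofReal ((64 : ℝ) ^ (m + 1) * ((4 * π) ^ d * ((1 / 2 : ℝ) ^ d) ^ m)) := by
          rw [ENNReal.ofReal_mul (p := (64 : ℝ) ^ (m + 1)) (by positivity),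
            ENNReal.ofReal_pow (p := (64 : ℝ)) (by norm_num), ENNReal.ofReal_ofNat]
      _ ≤ ENNReal.ofReal (64 * (4 * π) ^ d * (1 / 2) ^ m) := ENNReal.ofReal_le_ofReal hreal
      _ = ENNReal.ofReal (64 * (4 * π) ^ d) * 2⁻¹ ^ m := by
          rw [ENNReal.ofReal_mul (by positivity), ENNReal.ofReal_pow (by norm_num) m, one_div,
            ENNReal.ofReal_inv_of_pos two_pos, ENNReal.ofReal_ofNat]
  have step2 : ∑' m : ℕ, (64 : ℝ≥0∞) ^ (m + 1) * P d {k | S d k ≤ (1 / 4 : ℝ) ^ m} ≤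
      ENNReal.ofReal (64 * (4 * π) ^ d) * 2 := by
    calc _ ≤ ∑' m : ℕ, ENNReal.ofReal (64 * (4 * π) ^ d) * 2⁻¹ ^ m := ENNReal.tsum_le_tsum hterm
      _ = ENNReal.ofReal (64 * (4 * π) ^ d) * 2 := by
          rw [ENNReal.tsum_mul_left, ENNReal.tsum_geometric_two]
  refine lt_of_le_of_lt (step1.trans (add_le_add le_rfl step2)) ?_
  exact ENNReal.add_lt_top.2 ⟨measure_lt_top _ _,
    ENNReal.mul_lt_top ENNReal.ofReal_lt_top ENNReal.ofNat_lt_top⟩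

/-- `k ↦ S(k)^{-3}` is integrable on the cube for `d ≥ 7`. [cite: HeydenreichVanDerHofstad2017, (5.1.10)–(5.1.12)] -/
theorem integrable_inv_S_pow_three (hd : 7 ≤ d) : Integrable (fun k => (S d k)⁻¹ ^ 3) (P d) := by
  refine ⟨((continuous_S d).measurable.inv.pow_const 3).aestronglyMeasurable, ?_⟩
  rw [hasFiniteIntegral_iff_ofReal (ae_of_all _ fun k => pow_nonneg (inv_nonneg.2 (S_nonneg d k)) 3)]
  exact lintegral_inv_S_pow_three_lt_top hd

/-- The origin is a null set of the cube `[-π,π]^d` (`d ≥ 1`). [folklore] -/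
theorem P_singleton_zero (hd : 1 ≤ d) : P d {0} = 0 := by
  have : ({(0 : Fin d → ℝ)} : Set (Fin d → ℝ)) = Set.univ.pi fun _ => {(0 : ℝ)} := by
    ext k; simp [funext_iff]
  rw [this, P, Measure.pi_pi]
  refine Finset.prod_eq_zero (Finset.mem_univ ⟨0, hd⟩) ?_
  show μI {0} = 0
  unfold μI
  exact le_antisymm ((Measure.restrict_apply_le _ _).trans (measure_singleton (0 : ℝ)).le) zero_le

end Literature.Probability.Percolation

end
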